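import Mathlib
import Summits.NavierStokesRegularity.NavierStokesRegularity.Theorems.FilamentSkeletonRssClause13TwoZoneFence
import Summits.NavierStokesRegularity.NavierStokesRegularity.Theorems.FilamentSkeletonRssClause13WeightedFence

/-!
# Clause 13-J/13-R, brick m3b-Zw (TWO-ZONE CHAIN WITH GROWING FORCING): the amplified zone tolerates `‖f(τ)‖ ≤ M·((τ−c)/(d−c))^{p_f}`

Route `FilamentSkeletonRss`, ∃-side clause 13 (`Clause13RNearStraightL`, stmt-NavierStokesRegularity-23612; typing-agnostic).  Design of record
rev 80–82 (m3b; tenure R-m3b-2 "(iii) polynomial weights = bookkeeping of the OUTPUT weight only") and lane memo `DESIGN-28296-model-Linfty-g18.md`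
§3 (m3-w): to state the model `L∞` estimate in the clause's WEIGHTED shape `‖Y(τ)‖ ≤ cnd·(1+|τ−c|/ℓ)^p·(…)` (instead of a sup over the ball, which
costs `(R/ℓ)^p`), the far transport chain must accept a forcing that itself grows like the weight in the amplified zone — the commutator terms of
`norm_modelOperator_far_le` carry `sup‖Y‖`, which in the weighted bootstrap is `≤ S·(1+|τ−c|/ℓ)^p`.  This file extends the landed chain
(`waist_norm_le_of_damped_var`, `farBranch_norm_le_weighted_var`, p714527; `twoZone_norm_le_var`, p719470):
* §1 `farBranch_norm_le_weighted_forced_var` — amplified zone `[d, b]` (`c < d`, `w ≥ w₁(τ−c)`) with `‖f(τ)‖ ≤ M·((τ−c)/(d−c))^{p_f}`,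
  `0 ≤ p_f ≤ p`, growth booked as `Re α + β₀ + junk ≤ p·w₁`, `‖z(d)‖ ≤ M/β₀`: still `‖z(τ)‖ ≤ ((τ−c)/(d−c))^p·K·M` (the weight `ρ^{−p}` absorbs
  the forcing growth `ρ^{p_f}`);
* §2 ★ `twoZone_norm_le_forced_var` — `‖f‖ ≤ M` on `[c, d]`, `‖f‖ ≤ M·ρ^{p_f}` on `[d, b]`: `‖z‖ ≤ K·M` on `[c, d]`, `‖z(τ)‖ ≤ ρ^p·K·(β₀K·M)` on
  `[d, b]` (`K = ((1+k)/β₀)/(1−k)`, `k = β_max/(2G)`); §3 ★ `twoZone_norm_le_forced_var_left` — mirror by `τ ↦ 2c − τ`.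
Lane ns-filament-19175-p1 g18; `--supports stmt-NavierStokesRegularity-23612 --as helper`.
HONEST FRAMING: ODE lemmas for the bookkeeping of a HYPOTHETICAL filament skeleton on the NEGATIVE side of a MODEL route; nothing here bears on
Navier–Stokes regularity or blow-up; 23610/23612 stay OPEN.
-/

noncomputable section

open scoped InnerProductSpace ComplexConjugate
open Set Complex MeasureTheory Filter Topology

namespace Summit.NavierStokesRegularity.NavierStokesRegularity.Theorems.Clause13Transport
set_option linter.dupNamespace false

/-! ## §1 The amplified zone with growing forcing -/

/-- **AMPLIFIED ZONE, WEIGHTED OUTWARD INTEGRATION, FORCING GROWING LIKE `ρ^{p_f}`.**  `w·z′ = iG z + α(τ)z + β(τ)z̄ + f` on `[d, b]` (`z, β ∈ C¹`),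
`c < d`, `w` continuous with `w(τ) ≥ w₁(τ−c)` (`w₁ > 0`), `‖β‖ ≤ β_max ≤ G`, `‖f(τ)‖ ≤ M·((τ−c)/(d−c))^{p_f}` with `0 ≤ p_f ≤ p`, `‖z(d)‖ ≤ M/β₀`, and
`Re α(τ) + β₀ + (k/(1−k))(2|Im α(τ)| + k‖β(τ)‖) + (w(τ)‖β′(τ)‖/(2G))/(1−k) ≤ p·w₁` on `[d, b]` (`k = β_max/(2G)`).  Then
`‖z(τ)‖ ≤ ((τ−c)/(d−c))^p·((1+k)M/β₀)/(1−k)` on `[d, b]`. [folklore] -/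
theorem farBranch_norm_le_weighted_forced_var {z z' f α β β' : ℝ → ℂ} {w : ℝ → ℝ} {c d b G M β₀ βmax w₁ p pf : ℝ}
    (hG : 0 < G) (hM : 0 ≤ M) (hβ₀ : 0 < β₀) (hβmax0 : 0 ≤ βmax) (hcd : c < d) (hw₁ : 0 < w₁) (hpf0 : 0 ≤ pf) (hpfp : pf ≤ p)
    (hz : ∀ τ ∈ Icc d b, HasDerivAt z (z' τ) τ) (hβ : ∀ τ ∈ Icc d b, HasDerivAt β (β' τ) τ)
    (hwcont : Continuous w) (hw : ∀ τ ∈ Icc d b, w₁ * (τ - c) ≤ w τ)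
    (hode : ∀ τ ∈ Icc d b, (w τ : ℂ) * z' τ = I * G * z τ + α τ * z τ + β τ * conj (z τ) + f τ)
    (hf : ∀ τ ∈ Icc d b, ‖f τ‖ ≤ M * ((τ - c) / (d - c)) ^ pf) (hβmax : ∀ τ ∈ Icc d b, ‖β τ‖ ≤ βmax) (hsmall : βmax ≤ G)
    (hgrow : ∀ τ ∈ Icc d b, (α τ).re + β₀
      + (βmax / (2 * G)) / (1 - βmax / (2 * G)) * (2 * |(α τ).im| + βmax / (2 * G) * ‖β τ‖)
      + (w τ * ‖β' τ‖ / (2 * G)) / (1 - βmax / (2 * G)) ≤ p * w₁)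
    (hd : ‖z d‖ ≤ M / β₀) :
    ∀ τ ∈ Icc d b, ‖z τ‖ ≤ ((τ - c) / (d - c)) ^ p * (((1 + βmax / (2 * G)) * M / β₀) / (1 - βmax / (2 * G))) := by
  have hp0 : 0 ≤ p := hpf0.trans hpfp
  have hdc : 0 < d - c := by linarith
  have hwpos : ∀ t ∈ Icc d b, 0 < w t := fun t ht => lt_of_lt_of_le (by nlinarith [ht.1]) (hw t ht)
  -- the phase on `[d, b]` and the rotating frame `u = e^{-iθ} z`
  have hθ := hasDerivAt_phase_integral (G := G) (a := d) (b := b) hwcont hwpos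
  set θ : ℝ → ℝ := fun r => ∫ s in d..r, G / w s with hθdef
  have hwθ : ∀ t ∈ Icc d b, w t * (G / w t) = G := fun t ht => mul_div_cancel₀ G (hwpos t ht).ne'
  set u : ℝ → ℂ := fun r => cexp (-I * (θ r : ℂ)) * z r with hudef
  set u' : ℝ → ℂ := fun t => cexp (-I * (θ t : ℂ)) * (-I * ((G / w t : ℝ) : ℂ)) * z t + cexp (-I * (θ t : ℂ)) * z' t with hu'def
  have hrot : ∀ t ∈ Icc d b, HasDerivAt u (u' t) t ∧
      (w t : ℂ) * u' t = α t * u t + β t * cexp (-2 * I * (θ t : ℂ)) * conj (u t) + cexp (-I * (θ t : ℂ)) * f t :=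
    fun t ht => rotatingFrame (α := α t) (β := β t) (hz t ht) (hθ t ht) (hwθ t ht) (hode t ht)
  have hph : ∀ r : ℝ, ‖cexp (-I * (r : ℂ))‖ = 1 := norm_cexp_neg_I_mul
  -- the weight and the conjugated unknown `v = ρ^{-p} u`
  set W : ℝ → ℝ := fun r => ((r - c) / (d - c)) ^ (-p) with hW
  have hWf : ∀ t ∈ Icc d b, 0 < W t ∧ W t ≤ 1 ∧ HasDerivAt W (-(p / (t - c)) * W t) t :=
    fun t ht => weight_facts hcd hp0 ht.1
  set v : ℝ → ℂ := fun r => (W r : ℂ) * u r with hvdef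
  set v' : ℝ → ℂ := fun t => ((-(p / (t - c)) * W t : ℝ) : ℂ) * u t + (W t : ℂ) * u' t with hv'def
  have hvder : ∀ t ∈ Icc d b, HasDerivAt v (v' t) t :=
    fun t ht => ((hWf t ht).2.2.ofReal_comp).mul ((hrot t ht).1)
  set αv : ℝ → ℂ := fun t => α t - ((p * w t / (t - c) : ℝ) : ℂ) with hαv
  set g : ℝ → ℂ := fun t => (W t : ℂ) * (cexp (-I * (θ t : ℂ)) * f t) with hgdef
  have hodev : ∀ t ∈ Icc d b, (w t : ℂ) * v' t = αv t * v t + β t * cexp (-2 * I * (θ t : ℂ)) * conj (v t) + g t := by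
    intro t ht
    have htc : (t - c) ≠ 0 := by have := ht.1; linarith
    have h := (hrot t ht).2
    simp only [hv'def, hvdef, hαv, hgdef, map_mul, Complex.conj_ofReal]
    have e1 : (w t : ℂ) * ((((-(p / (t - c)) * W t : ℝ) : ℂ)) * u t + (W t : ℂ) * u' t)
        = (W t : ℂ) * ((w t : ℂ) * u' t) - ((p * w t / (t - c) : ℝ) : ℂ) * ((W t : ℂ) * u t) := by
      push_cast
      field_simp
      ring
    rw [e1, h]
    ring
  -- the conjugated forcing: `ρ^{-p}·M ρ^{p_f} ≤ M`
  have hg : ∀ t ∈ Icc d b, ‖g t‖ ≤ M := by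
    intro t ht
    have hρ1 : 1 ≤ (t - c) / (d - c) := by rw [le_div_iff₀ hdc]; linarith [ht.1]
    have hρpos : 0 < (t - c) / (d - c) := by positivity
    simp only [hgdef]
    rw [norm_mul, norm_mul, hph, one_mul, Complex.norm_real, Real.norm_eq_abs, abs_of_pos (hWf t ht).1]
    have h1 : W t * ‖f t‖ ≤ W t * (M * ((t - c) / (d - c)) ^ pf) := mul_le_mul_of_nonneg_left (hf t ht) (hWf t ht).1.le
    have h2 : W t * (M * ((t - c) / (d - c)) ^ pf) = M * ((t - c) / (d - c)) ^ (pf - p) := by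
      simp only [hW]
      rw [show pf - p = pf + -p by ring, Real.rpow_add hρpos]
      ring
    have h3 : ((t - c) / (d - c)) ^ (pf - p) ≤ 1 := Real.rpow_le_one_of_one_le_of_nonpos hρ1 (by linarith)
    calc W t * ‖f t‖ ≤ M * ((t - c) / (d - c)) ^ (pf - p) := h1.trans (le_of_eq h2)
      _ ≤ M * 1 := mul_le_mul_of_nonneg_left h3 hM
      _ = M := mul_one M
  have hgain : ∀ t ∈ Icc d b, β₀ ≤ -(αv t).re
      - (βmax / (2 * G)) / (1 - βmax / (2 * G)) * (2 * |(αv t).im| + βmax / (2 * G) * ‖β t‖)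
      - (w t * ‖β' t‖ / (2 * G)) / (1 - βmax / (2 * G)) := by
    intro t ht
    have htc : 0 < t - c := by linarith [ht.1]
    have hre : (αv t).re = (α t).re - p * w t / (t - c) := by simp only [hαv, Complex.sub_re, Complex.ofReal_re]
    have him : (αv t).im = (α t).im := by simp only [hαv, Complex.sub_im, Complex.ofReal_im, sub_zero]
    rw [hre, him]
    have h3 : p * w₁ ≤ p * w t / (t - c) := by
      rw [le_div_iff₀ htc]; nlinarith [hw t ht, hp0]
    have h4 := hgrow t ht
    linarith
  have hWd : W d = 1 := by simp only [hW]; rw [div_self hdc.ne', Real.one_rpow]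
  have hθd : θ d = 0 := by simp only [hθdef, intervalIntegral.integral_same]
  have hvd : ‖v d‖ ≤ M / β₀ := by
    simp only [hvdef, hudef]
    rw [hWd, norm_mul, norm_mul, hph, Complex.ofReal_one, norm_one, one_mul, one_mul]; exact hd
  have hfence := farBranch_norm_le_of_damped_var (α := αv) (β := β) (β' := β') (βmax := βmax) hG hM hβ₀ hβmax0 hvder
    hθ hβ hwpos hwθ hodev hg hβmax hsmall hgain hvd
  intro τ hτ
  have hWτ := (hWf τ hτ).1
  have hρpos : 0 < (τ - c) / (d - c) := div_pos (by linarith [hτ.1]) hdc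
  have hzτ : ‖z τ‖ = ((τ - c) / (d - c)) ^ p * ‖v τ‖ := by
    simp only [hvdef, hudef]
    rw [norm_mul, norm_mul, hph, one_mul, Complex.norm_real, Real.norm_eq_abs, abs_of_pos hWτ, ← mul_assoc, hW,
      ← Real.rpow_add hρpos, add_neg_cancel, Real.rpow_zero, one_mul]
  rw [hzτ]
  exact mul_le_mul_of_nonneg_left (hfence τ hτ) (Real.rpow_nonneg hρpos.le _)

/-! ## §2 The two zones with growing forcing (right side) -/

/-- ★ **TWO-ZONE CHAIN WITH GROWING FORCING (right side).**  As `twoZone_norm_le_var` (p719470), but the forcing is bounded by `M` on the damped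
zone `[c, d]` and by `M·((τ−c)/(d−c))^{p_f}` on the amplified zone `[d, b]`, `0 ≤ p_f ≤ p`.  Then `‖z‖ ≤ K·M` on `[c, d]` and
`‖z(τ)‖ ≤ ((τ−c)/(d−c))^p·K·(β₀K·M)` on `[d, b]`, `K = ((1+k)/β₀)/(1−k)`. [folklore] -/
theorem twoZone_norm_le_forced_var {z z' f α β β' : ℝ → ℂ} {w : ℝ → ℝ} {c d b G M β₀ βmax w₁ p pf : ℝ}
    (hG : 0 < G) (hM : 0 ≤ M) (hβ₀ : 0 < β₀) (hβmax0 : 0 ≤ βmax) (hcd : c < d) (hdb : d ≤ b) (hw₁ : 0 < w₁) (hpf0 : 0 ≤ pf) (hpfp : pf ≤ p)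
    (hz : ∀ τ ∈ Icc c b, HasDerivAt z (z' τ) τ) (hβ : ∀ τ ∈ Icc c b, HasDerivAt β (β' τ) τ)
    (hwcont : Continuous w) (hwc : w c = 0) (hw : ∀ τ ∈ Ioc c b, 0 < w τ) (hw1 : ∀ τ ∈ Icc d b, w₁ * (τ - c) ≤ w τ)
    (hode : ∀ τ ∈ Icc c b, (w τ : ℂ) * z' τ = I * G * z τ + α τ * z τ + β τ * conj (z τ) + f τ)
    (hf : ∀ τ ∈ Icc c d, ‖f τ‖ ≤ M) (hf' : ∀ τ ∈ Icc d b, ‖f τ‖ ≤ M * ((τ - c) / (d - c)) ^ pf)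
    (hβmax : ∀ τ ∈ Icc c b, ‖β τ‖ ≤ βmax) (hsmall : βmax ≤ G)
    (hgain : ∀ τ ∈ Icc c d, β₀ ≤ -(α τ).re
      - (βmax / (2 * G)) / (1 - βmax / (2 * G)) * (2 * |(α τ).im| + βmax / (2 * G) * ‖β τ‖)
      - (w τ * ‖β' τ‖ / (2 * G)) / (1 - βmax / (2 * G)))
    (hstag : β₀ ≤ G - ‖α c‖ - ‖β c‖)
    (hgrow : ∀ τ ∈ Icc d b, (α τ).re + β₀
      + (βmax / (2 * G)) / (1 - βmax / (2 * G)) * (2 * |(α τ).im| + βmax / (2 * G) * ‖β τ‖)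
      + (w τ * ‖β' τ‖ / (2 * G)) / (1 - βmax / (2 * G)) ≤ p * w₁) :
    (∀ τ ∈ Icc c d, ‖z τ‖ ≤ ((1 + βmax / (2 * G)) / β₀) / (1 - βmax / (2 * G)) * M) ∧
    (∀ τ ∈ Icc d b, ‖z τ‖ ≤ ((τ - c) / (d - c)) ^ p *
        ((((1 + βmax / (2 * G)) / β₀) / (1 - βmax / (2 * G))) *
          ((β₀ * (((1 + βmax / (2 * G)) / β₀) / (1 - βmax / (2 * G)))) * M))) := by
  have hk1 : βmax / (2 * G) ≤ 1 / 2 := by rw [div_le_iff₀ (by positivity)]; linarith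
  have h1k : 0 < 1 - βmax / (2 * G) := by linarith
  set K : ℝ := ((1 + βmax / (2 * G)) / β₀) / (1 - βmax / (2 * G)) with hKdef
  have hK0 : 0 < K := by positivity
  -- damped zone
  have hsub1 : Icc c d ⊆ Icc c b := Icc_subset_Icc le_rfl hdb
  have hdz := waist_norm_le_of_damped_var (b := d) hG hM hβ₀ hβmax0 (fun t ht => hz t (hsub1 ht)) (fun t ht => hβ t (hsub1 ht)) hwcont hwc
    (fun t ht => hw t ⟨ht.1, ht.2.trans hdb⟩) (fun t ht => hode t (hsub1 ht)) hf
    (fun t ht => hβmax t (hsub1 ht)) hsmall hgain hstag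
  have hdz' : ∀ τ ∈ Icc c d, ‖z τ‖ ≤ K * M := by
    intro τ hτ
    refine (hdz τ hτ).trans (le_of_eq ?_)
    simp only [hKdef]
    field_simp
  refine ⟨hdz', ?_⟩
  -- amplified zone, forcing level `M' = β₀ K M ≥ M`
  have hβ₀K : 1 ≤ β₀ * K := by
    simp only [hKdef]
    rw [show β₀ * ((1 + βmax / (2 * G)) / β₀ / (1 - βmax / (2 * G))) = (1 + βmax / (2 * G)) / (1 - βmax / (2 * G)) by
      field_simp]
    rw [le_div_iff₀ h1k]
    linarith [show 0 ≤ βmax / (2 * G) by positivity]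
  have hM' : 0 ≤ β₀ * K * M := by positivity
  have hsub2 : Icc d b ⊆ Icc c b := Icc_subset_Icc hcd.le le_rfl
  have hf'' : ∀ τ ∈ Icc d b, ‖f τ‖ ≤ β₀ * K * M * ((τ - c) / (d - c)) ^ pf := by
    intro τ hτ
    refine (hf' τ hτ).trans ?_
    have hρ : 0 ≤ ((τ - c) / (d - c)) ^ pf := Real.rpow_nonneg (div_nonneg (by linarith [hτ.1]) (by linarith)) _
    have := mul_le_mul_of_nonneg_right hβ₀K hM
    nlinarith
  have hd' : ‖z d‖ ≤ β₀ * K * M / β₀ := by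
    rw [show β₀ * K * M / β₀ = K * M by field_simp]
    exact hdz' d (right_mem_Icc.2 hcd.le)
  have haz := farBranch_norm_le_weighted_forced_var (b := b) hG hM' hβ₀ hβmax0 hcd hw₁ hpf0 hpfp (fun t ht => hz t (hsub2 ht))
    (fun t ht => hβ t (hsub2 ht)) hwcont hw1 (fun t ht => hode t (hsub2 ht)) hf'' (fun t ht => hβmax t (hsub2 ht)) hsmall hgrow hd'
  intro τ hτ
  refine (haz τ hτ).trans (le_of_eq ?_)
  simp only [hKdef]
  field_simp

/-! ## §3 The left side (reflection `τ ↦ 2c − τ`) -/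

/-- ★ **Left twin of `twoZone_norm_le_forced_var`**: on `[b, c]`, `w < 0` on `[b, c)`, damped zone `[e, c]` (`‖f‖ ≤ M`), amplified zone `[b, e]`
(`−w ≥ w₁(c−τ)`, `‖f(τ)‖ ≤ M·((c−τ)/(c−e))^{p_f}`), variation terms with `−w`.  Then `‖z‖ ≤ K·M` on `[e, c]` and
`‖z(τ)‖ ≤ ((c−τ)/(c−e))^p·K·(β₀K·M)` on `[b, e]`. [folklore] -/
theorem twoZone_norm_le_forced_var_left {z z' f α β β' : ℝ → ℂ} {w : ℝ → ℝ} {c e b G M β₀ βmax w₁ p pf : ℝ}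
    (hG : 0 < G) (hM : 0 ≤ M) (hβ₀ : 0 < β₀) (hβmax0 : 0 ≤ βmax) (hec : e < c) (hbe : b ≤ e) (hw₁ : 0 < w₁) (hpf0 : 0 ≤ pf) (hpfp : pf ≤ p)
    (hz : ∀ τ ∈ Icc b c, HasDerivAt z (z' τ) τ) (hβ : ∀ τ ∈ Icc b c, HasDerivAt β (β' τ) τ)
    (hwcont : Continuous w) (hwc : w c = 0) (hw : ∀ τ ∈ Ico b c, w τ < 0) (hw1 : ∀ τ ∈ Icc b e, w₁ * (c - τ) ≤ -w τ)
    (hode : ∀ τ ∈ Icc b c, (w τ : ℂ) * z' τ = I * G * z τ + α τ * z τ + β τ * conj (z τ) + f τ)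
    (hf : ∀ τ ∈ Icc e c, ‖f τ‖ ≤ M) (hf' : ∀ τ ∈ Icc b e, ‖f τ‖ ≤ M * ((c - τ) / (c - e)) ^ pf)
    (hβmax : ∀ τ ∈ Icc b c, ‖β τ‖ ≤ βmax) (hsmall : βmax ≤ G)
    (hgain : ∀ τ ∈ Icc e c, β₀ ≤ -(α τ).re
      - (βmax / (2 * G)) / (1 - βmax / (2 * G)) * (2 * |(α τ).im| + βmax / (2 * G) * ‖β τ‖)
      - (-w τ * ‖β' τ‖ / (2 * G)) / (1 - βmax / (2 * G)))
    (hstag : β₀ ≤ G - ‖α c‖ - ‖β c‖)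
    (hgrow : ∀ τ ∈ Icc b e, (α τ).re + β₀
      + (βmax / (2 * G)) / (1 - βmax / (2 * G)) * (2 * |(α τ).im| + βmax / (2 * G) * ‖β τ‖)
      + (-w τ * ‖β' τ‖ / (2 * G)) / (1 - βmax / (2 * G)) ≤ p * w₁) :
    (∀ τ ∈ Icc e c, ‖z τ‖ ≤ ((1 + βmax / (2 * G)) / β₀) / (1 - βmax / (2 * G)) * M) ∧
    (∀ τ ∈ Icc b e, ‖z τ‖ ≤ ((c - τ) / (c - e)) ^ p *
        ((((1 + βmax / (2 * G)) / β₀) / (1 - βmax / (2 * G))) *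
          ((β₀ * (((1 + βmax / (2 * G)) / β₀) / (1 - βmax / (2 * G)))) * M))) := by
  -- reflected data on `[c, 2c - b]`, split point `2c - e`
  have hmem : ∀ s ∈ Icc c (2 * c - b), 2 * c - s ∈ Icc b c := fun s hs => ⟨by linarith [hs.2], by linarith [hs.1]⟩
  have hrefl : ∀ s : ℝ, HasDerivAt (fun r : ℝ => 2 * c - r) (-1) s := fun s => by
    simpa using (hasDerivAt_id s).const_sub (2 * c)
  have hzr : ∀ s ∈ Icc c (2 * c - b), HasDerivAt (fun r => z (2 * c - r)) (-z' (2 * c - s)) s := by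
    intro s hs
    have h := (hz (2 * c - s) (hmem s hs)).scomp s (hrefl s)
    simpa [Function.comp_def] using h
  have hβr : ∀ s ∈ Icc c (2 * c - b), HasDerivAt (fun r => β (2 * c - r)) (-β' (2 * c - s)) s := by
    intro s hs
    have h := (hβ (2 * c - s) (hmem s hs)).scomp s (hrefl s)
    simpa [Function.comp_def] using h
  have hwr : Continuous fun r => -w (2 * c - r) := (hwcont.comp (continuous_const.sub continuous_id)).neg
  have hwrc : -w (2 * c - c) = 0 := by rw [show 2 * c - c = c by ring, hwc, neg_zero]
  have hwrpos : ∀ s ∈ Ioc c (2 * c - b), 0 < -w (2 * c - s) := by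
    intro s hs
    have := hw (2 * c - s) ⟨by linarith [hs.2], by linarith [hs.1]⟩
    linarith
  have hwr1 : ∀ s ∈ Icc (2 * c - e) (2 * c - b), w₁ * (s - c) ≤ -w (2 * c - s) := by
    intro s hs
    have := hw1 (2 * c - s) ⟨by linarith [hs.2], by linarith [hs.1]⟩
    rw [show c - (2 * c - s) = s - c by ring] at this
    exact this
  have hoder : ∀ s ∈ Icc c (2 * c - b), ((-w (2 * c - s) : ℝ) : ℂ) * (-z' (2 * c - s))
      = I * G * z (2 * c - s) + α (2 * c - s) * z (2 * c - s) + β (2 * c - s) * conj (z (2 * c - s)) + f (2 * c - s) := by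
    intro s hs
    rw [← hode (2 * c - s) (hmem s hs)]; push_cast; ring
  have hfr : ∀ s ∈ Icc c (2 * c - e), ‖f (2 * c - s)‖ ≤ M := fun s hs => hf _ ⟨by linarith [hs.2], by linarith [hs.1]⟩
  have hfr' : ∀ s ∈ Icc (2 * c - e) (2 * c - b), ‖f (2 * c - s)‖ ≤ M * ((s - c) / (2 * c - e - c)) ^ pf := by
    intro s hs
    have h := hf' (2 * c - s) ⟨by linarith [hs.2], by linarith [hs.1]⟩
    rw [show c - (2 * c - s) = s - c by ring, show c - e = 2 * c - e - c by ring] at h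
    exact h
  have hβmaxr : ∀ s ∈ Icc c (2 * c - b), ‖β (2 * c - s)‖ ≤ βmax := fun s hs => hβmax _ (hmem s hs)
  have hgainr : ∀ s ∈ Icc c (2 * c - e), β₀ ≤ -(α (2 * c - s)).re
      - (βmax / (2 * G)) / (1 - βmax / (2 * G)) * (2 * |(α (2 * c - s)).im| + βmax / (2 * G) * ‖β (2 * c - s)‖)
      - (-w (2 * c - s) * ‖-β' (2 * c - s)‖ / (2 * G)) / (1 - βmax / (2 * G)) := by
    intro s hs
    rw [norm_neg]
    exact hgain (2 * c - s) ⟨by linarith [hs.2], by linarith [hs.1]⟩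
  have hstagr : β₀ ≤ G - ‖α (2 * c - c)‖ - ‖β (2 * c - c)‖ := by rw [show 2 * c - c = c by ring]; exact hstag
  have hgrowr : ∀ s ∈ Icc (2 * c - e) (2 * c - b), (α (2 * c - s)).re + β₀
      + (βmax / (2 * G)) / (1 - βmax / (2 * G)) * (2 * |(α (2 * c - s)).im| + βmax / (2 * G) * ‖β (2 * c - s)‖)
      + (-w (2 * c - s) * ‖-β' (2 * c - s)‖ / (2 * G)) / (1 - βmax / (2 * G)) ≤ p * w₁ := by
    intro s hs
    rw [norm_neg]
    exact hgrow (2 * c - s) ⟨by linarith [hs.2], by linarith [hs.1]⟩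
  have h := twoZone_norm_le_forced_var (z := fun r => z (2 * c - r)) (α := fun r => α (2 * c - r)) (β := fun r => β (2 * c - r))
    (β' := fun r => -β' (2 * c - r)) (f := fun r => f (2 * c - r)) (d := 2 * c - e) (b := 2 * c - b)
    hG hM hβ₀ hβmax0 (by linarith) (by linarith) hw₁ hpf0 hpfp hzr hβr hwr hwrc hwrpos hwr1 hoder hfr hfr' hβmaxr hsmall hgainr hstagr hgrowr
  refine ⟨fun τ hτ => ?_, fun τ hτ => ?_⟩
  · have h1 := h.1 (2 * c - τ) ⟨by linarith [hτ.2], by linarith [hτ.1]⟩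
    simpa using h1
  · have h2 := h.2 (2 * c - τ) ⟨by linarith [hτ.2], by linarith [hτ.1]⟩
    have e1 : (2 * c - τ - c) / (2 * c - e - c) = (c - τ) / (c - e) := by
      congr 1 <;> ring
    rw [e1] at h2
    simpa using h2

end Summit.NavierStokesRegularity.NavierStokesRegularity.Theorems.Clause13Transport

end
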